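import Summits.ABC.IUTFork.Joshi.AnsatzStandardPoint
import Mathlib.Data.Countable.Basic
import Mathlib.Data.Set.Countable
import Mathlib.Data.Fintype.Card
import Mathlib.Logic.Function.Basic
import HarnessLib

/-!
# [J-III] Rmk. 4.4.2 — the countability sentence made precise over the §4.4 carrier (E-ref finding R5, kernel form)

Proof-only companion (abc-iut cell, block E, rung LADDER-ABC:A2.E; seat abc-iut-E-t8, slot T-08) of
`Joshi/AnsatzStandardPoint.lean` (p429131), answering finding **R5** of the faithfulness sheet
`HOME/plan/E/ref/FAITHFUL-AdelicAnsatzPeriod.md` (abc-iut-E-ref) with a kernel statement. SOURCE: K. Joshi,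
arXiv:2401.13508v4 («[J-III]», unrefereed), Rmk. 4.4.2, p.36 l.1–10: "there are countably infinite possible choices for
the standard point `y_0` … This is because the set of valuations `V_L` of any number field `L` is countable and for each
`v ∈ V_L`, the set of possible choices of closed classical points `y_v` (chosen as above) is countable hence the set of
`y_0 = (y_v)_{v ∈ V_L}` as above is countable" — typed VERBATIM in p429131 as the claim-Prop
`AnsatzCurveDatum.StandardPointsCountable` (never asserted). R5 (E-ref, located not adjudicated): for the UNRESTRICTED set of
sections the printed "hence" does not follow — no restricted-product / almost-all constraint appears in §4.4, Rmk. 4.4.2 or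
[J-IIh] §7.1.

WHAT IS PROVED (`AnsatzCurveDatum.not_countable_standardPoints`): over the §4.4 signature, IF infinitely many
non-archimedean places `w` carry TWO distinct closed classical points over the canonical point (print: the fibre is a
`φ^ℤ`-orbit, "countably infinite possible choices"), and standard choices exist at the remaining non-archimedean places,
THEN the set `standardPoints` of §4.4 is NOT countable (Cantor: the sections encode every subset of that infinite set of
places). Hence, under those hypotheses, the first conjunct of `StandardPointsCountable` FAILS (`not_standardPointsCountable`).
This is a statement about OUR abstract signature under explicit hypotheses; whether Joshi intends a finiteness convention
elsewhere is NOT adjudicated (R5); the claim-Prop keeps no in-tree consumer. CONSUMPTION RULE (sheet §D (ii)) made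
checkable: any future instantiation asserting `StandardPointsCountable` must violate one of the hypotheses below (e.g. work
in a restricted product). TAKES NO SIDE on [IUTchIII] Cor. 3.12 or on any author; typed ≠ proved. Mathlib only (Cantor:
`Function.cantor_surjective`); no `Cor312*`/`Thm311*` import (E-PLAN R14). Standard axioms; sorry-free.
-/

noncomputable section

open Set Function

namespace Summit.ABC.IUTFork.Joshi

namespace AnsatzCurveDatum

variable (A : AnsatzCurveDatum)

/-- The power set of an infinite type is not countable (Cantor) — auxiliary, Mathlib-level. [folklore] -/
theorem not_countable_set_of_infinite (W : Type) [Infinite W] : ¬ Countable (Set W) := by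
  intro hc
  -- restrict along an embedding `ℕ ↪ W`: `Set W → Set ℕ`, `s ↦ e ⁻¹' s`, is surjective
  let e : ℕ ↪ W := Infinite.natEmbedding W
  have hsurj : Surjective (fun s : Set W => e ⁻¹' s) := by
    intro t
    refine ⟨e '' t, ?_⟩
    exact preimage_image_eq t e.injective
  haveI : Countable (Set ℕ) := hsurj.countable
  -- a countable nonempty type admits a surjection from `ℕ`; Cantor forbids `ℕ ↠ Set ℕ`
  obtain ⟨f, hf⟩ := exists_surjective_nat (Set ℕ)
  exact cantor_surjective f hf

open Classical in
/-- **R5 in kernel form.** Over the §4.4 signature: let `W` be an INFINITE set of places (print: `W ⊆ V^non_{L′}`, which is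
countably infinite) at each of which two DISTINCT closed classical points `a_w ≠ b_w` lie over the canonical point, `a`
being a standard point (§4.4: over the canonical point at every non-archimedean place; at archimedean places anything). Then the set of standard points of
§4.4 is not countable: `s ↦ (w ↦ b_w if w ∈ s else a_w)` injects `Set W` into `standardPoints`. [folklore] -/
theorem not_countable_standardPoints (W : Set A.V) (hW : W.Infinite)
    (a b : A.AdelicPoint) (ha : A.IsStandardPoint a) (hb : ∀ w ∈ W, A.quot w (b w) = A.canon w)
    (hab : ∀ w ∈ W, a w ≠ b w) : ¬ A.standardPoints.Countable := by
  intro hc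
  haveI : Infinite W := hW.to_subtype
  -- the encoding of subsets of `W` by sections
  let f : Set W → A.AdelicPoint := fun s w => if (∃ h : w ∈ W, (⟨w, h⟩ : W) ∈ s) then b w else a w
  have hf_std : ∀ s, f s ∈ A.standardPoints := by
    intro s w hw
    show A.quot w (f s w) = A.canon w
    simp only [f]
    split_ifs with h
    · obtain ⟨hW', _⟩ := h
      exact hb w hW'
    · exact ha w hw
  have hf_inj : Injective f := by
    intro s t hst
    ext ⟨w, hw⟩
    have hw' := congrFun hst w
    simp only [f] at hw'
    constructor
    · intro hs
      by_contra ht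
      have h1 : (∃ h : w ∈ W, (⟨w, h⟩ : W) ∈ s) := ⟨hw, hs⟩
      have h2 : ¬ (∃ h : w ∈ W, (⟨w, h⟩ : W) ∈ t) := fun ⟨_, h⟩ => ht h
      rw [if_pos h1, if_neg h2] at hw'
      exact hab w hw hw'.symm
    · intro ht
      by_contra hs
      have h1 : ¬ (∃ h : w ∈ W, (⟨w, h⟩ : W) ∈ s) := fun ⟨_, h⟩ => hs h
      have h2 : (∃ h : w ∈ W, (⟨w, h⟩ : W) ∈ t) := ⟨hw, ht⟩
      rw [if_neg h1, if_pos h2] at hw'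
      exact hab w hw hw'
  -- `Set W` would be countable
  have hrange : (Set.range f).Countable := hc.mono (by rintro _ ⟨s, rfl⟩; exact hf_std s)
  haveI : Countable (Set.range f) := hrange.to_subtype
  have : Countable (Set W) :=
    (Function.Injective.countable (f := Set.rangeFactorization f)
      (fun s t h => hf_inj (congrArg Subtype.val h)))
  exact not_countable_set_of_infinite W this

/-- Consequently, under the hypotheses of `not_countable_standardPoints`, the claim-Prop `StandardPointsCountable` of
p429131 (Rmk. 4.4.2 AS PRINTED: "countable and infinite") fails at its first conjunct — E-ref R5 in kernel form; located,
not adjudicated (a restricted-product reading of the sections would evade the hypotheses). [folklore] -/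
theorem not_standardPointsCountable (W : Set A.V) (hW : W.Infinite)
    (a b : A.AdelicPoint) (ha : A.IsStandardPoint a) (hb : ∀ w ∈ W, A.quot w (b w) = A.canon w)
    (hab : ∀ w ∈ W, a w ≠ b w) : ¬ A.StandardPointsCountable := fun h =>
  A.not_countable_standardPoints W hW a b ha hb hab h.1

end AnsatzCurveDatum

end Summit.ABC.IUTFork.Joshi

end
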